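import Summits.BirchSwinnertonDyer.BirchSwinnertonDyer.Theorems.EdixhovenFibreFiveSevenStarredOptimalManinUnitFiveSevenTransportedReciprocityAllPoints
import Literature.NumberTheory.PAdicHodge.FormalDivisionTowersOrdinary
import HarnessLib

/-!
# Kato's explicit reciprocity law at ALL points of `E(K_v)` for a good `𝒪_D`-model FROM the formula at its deep FORMAL points — the GENERIC
# off-level step (supersingular OR ordinary), with the formal division towers CHOSEN inside `E₁(ℂ_F)`

Cell `pub/bsd-wall`, D-0145 line `route-BirchSwinnertonDyer-EdixhovenFibreFiveSeven`, seat `bsd-line-edix-p4` (gen 29, width); crux K★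
`stmt-BirchSwinnertonDyer-22226` (`StarredOptimalManinUnitFiveSeven`), line `kato_lever`, stub `stub_localFormulaOrdinaryCells` (memo
`Cruxes/StarredOptimalManinUnitFiveSeven/Lines/kato-lever-seam-rec-at-cells.md` §17, brick (B3) «assembly … at deep formal `P`», then «E3–E6 twins + cells»).
THEOREMS ONLY (no definition, no named fact, no instance, no `sorry`); helper `--supports stmt-BirchSwinnertonDyer-22226`. **BSD is not proved by this
file, and neither is K★ or the LOC@ord stub**: it ABSTRACTS the off-level upgrade of `…TransportedReciprocityAllPoints` (T5-D, g28) over its formal-point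
input. T5-D derived Kato's formula at every point of the ramified good SUPERSINGULAR model from T5-C (the formula at deep formal points with a free scalar
`c_P` pinned by the chart `p^N·Σ'[Xʲ]log_{W_D}·z(P)ʲ`), using that at supersingular reduction EVERY division sequence of a formal point is formal
(`geomToCO_divSeq_mem_kernel`, `A_p = 0`). Here the formal-point formula is a HYPOTHESIS `hformal` of EXACTLY T5-C's output shape, except that it may
additionally assume the division sequence `Q` to be formal at EVERY level (`hker : ∀ n`) — which is what the ORDINARY capstone (unit-root frame, height one:
`ι : T_pŴ ↪ T_pE` only, `FormalTateModuleInclusion.tateModuleOfPt_kummerCocycleO`) can deliver — and the model is only assumed to have `Δ ∈ 𝒪_Fˣ` and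
`[Xᵖ][p]` a unit in `𝒪_{ℂ_F}` (the hypothesis `h1` of `FormalGroupDivisionHeightOne` / `FormalDivisionTowersOrdinary`; at supersingular reduction use T5-D
itself). The proof is T5-D's, with the formal division tower of each point of the level CHOSEN by
`FormalDivisionTowersOrdinary.exists_divSeq_geomToCO_mem_kernel` (p794112).

* ★★★ `exists_const_tatePairingPoint_eq_trace_mul_padicLog_of_formalPoints` — **`hformal` (T5-C shape, `hker ∀ n`) ⟹ `∃ c, ∀ η P, ⟨[η], P⟩ =
  Tr_{F/ℚ_p}(c · exp*_d(η) · log_ω P)`** (T5-D shape = the model-side half of the socket `stub_localFormulaOrdinaryCells` before transport).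

What a consumer supplies: `hformal` = the ORDINARY capstone at deep formal points (LEAD B3) — or T5-C; then the transport to `W′ ⊗ F` (E3–E6 twins) and the cells
(`…OrdinaryCellsModels.exists_goodModelData_of_ordinaryCell`, p794676) as for the supersingular socket.

References: [cite: Kato1993LNM1553, Ch. II Thm. 1.4.1 (3)–(4), Lemma 1.4.3] · [cite: BlochKato1990, Ex. 3.10.1, Example 3.11] ·
[cite: SilvermanAEC2009, Thm. IV.6.4, Prop. VII.2.1–VII.2.2, VIII §2].
-/

set_option autoImplicit false
-- single-conjunct summit: `Summit.BirchSwinnertonDyer.BirchSwinnertonDyer.…` repeats the name by design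
set_option linter.dupNamespace false

noncomputable section

open Field Function ValuativeRel WittVector NumberField IsDedekindDomain
open scoped NumberField Topology Classical NNReal
open Literature.NumberTheory.PAdicHodge Literature.NumberTheory.GaloisRepresentations
  Literature.NumberTheory.GaloisRepresentations.IsNonarchimedeanLocalField Literature.NumberTheory.GaloisRepresentations.LubinTate
  Literature.NumberTheory.GaloisCohomology Literature.NumberTheory.EllipticCurves Literature.NumberTheory.EllipticCurves.FormalGroupChart
  Literature.NumberTheory.PAdicHodge.GaloisContinuity Literature.IUT.LogVolume Literature.RingTheory.FormalGroups
  Literature.AlgebraicGeometry.Resolution _root_.WeierstrassCurve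

namespace Summit.BirchSwinnertonDyer.BirchSwinnertonDyer.Theorems.TransportedReciprocityAllPointsOfFormalPoints

variable {K : Type} [Field K] [NumberField K] {p : ℕ} [hprime : Fact p.Prime] (v : HeightOneSpectrum (𝓞 K))
  [CharZero (v.adicCompletion K)] [Fact (¬ IsUnit (p : integerC (v.adicCompletion K)))]
  [IsAdicComplete (Ideal.span {(p : integerC (v.adicCompletion K))}) (integerC (v.adicCompletion K))]
  [CharZero (CompletedAlgClosure (v.adicCompletion K))]
  (hpv : valuation (v.adicCompletion K) (p : v.adicCompletion K) < 1)
  (Dv : EisensteinRoot (v.adicCompletion K) p hpv) (Wm : WeierstrassCurve (EisensteinRoot.CoeffDisc Dv))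
  (ψm : EisensteinRoot.CoeffDisc Dv →+* LTCoeff (v.adicCompletion K))
  (hψm : ∀ c, algebraMap (LTCoeff (v.adicCompletion K)) (v.adicCompletion K) (ψm c) = EisensteinRoot.CoeffDisc.toF Dv c)
  (hΔ : IsUnit (Wm.map ψm).Δ)
  -- `[Xᵖ][p]` a unit in `𝒪_{ℂ_F}` — the hypothesis of `FormalGroupDivisionHeightOne` / `FormalDivisionTowersOrdinary` (on the K★ ordinary cells: `…OrdinaryCellsModels`)
  (h1 : IsUnit (algebraMap (LTCoeff (v.adicCompletion K)) (CBall (v.adicCompletion K)) (PowerSeries.coeff p ((Wm.map ψm).formalMul p))))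
  [(AinfTop.curveFO (v.adicCompletion K) (Wm.map ψm)).IsElliptic]
  [(curveOver (CompletedAlgClosure (v.adicCompletion K)) (Wm.map ψm)).IsElliptic]
  (e : (k : ℕ) → geomTorsion (AinfTop.curveFO (v.adicCompletion K) (Wm.map ψm)) ((p ^ k : ℕ) : ℤ) →
    geomTorsion (AinfTop.curveFO (v.adicCompletion K) (Wm.map ψm)) ((p ^ k : ℕ) : ℤ) → AlgebraicClosure (v.adicCompletion K))
  (hμ : ∀ k S T, e k S T ^ (p ^ k) = 1) (hadd₁ : ∀ k S₁ S₂ T, e k (S₁ + S₂) T = e k S₁ T * e k S₂ T)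
  (hadd₂ : ∀ k S T₁ T₂, e k S (T₁ + T₂) = e k S T₁ * e k S T₂)
  (hgal : ∀ k (σ : absoluteGaloisGroup (v.adicCompletion K))
    (S T : geomTorsion (AinfTop.curveFO (v.adicCompletion K) (Wm.map ψm)) ((p ^ k : ℕ) : ℤ)), σ • e k S T = e k (σ • S) (σ • T))
  (hcompat : ∀ k (S T : geomTorsion (AinfTop.curveFO (v.adicCompletion K) (Wm.map ψm)) ((p ^ (k + 1) : ℕ) : ℤ)),
    e k (torsionMulHom (AinfTop.curveFO (v.adicCompletion K) (Wm.map ψm)) (p ^ (k + 1)) (p ^ k) p (pow_succ p k).symm S)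
      (torsionMulHom (AinfTop.curveFO (v.adicCompletion K) (Wm.map ψm)) (p ^ (k + 1)) (p ^ k) p (pow_succ p k).symm T) =
        e (k + 1) S T ^ p)
  -- a valuation of `F = K_v` compatible with its valuative structure, for `log_ω = padicLogPointFiniteExt w E p`
  (w : Valuation (v.adicCompletion K) ℝ≥0) [w.Compatible] [(AinfTop.curveFO (v.adicCompletion K) (Wm.map ψm)).IsIntegral w.integer]

set_option maxHeartbeats 3200000 in
include hΔ h1 hψm in
/-- ★★★ **ALL points from deep FORMAL points — generic off-level upgrade of Kato's formula for a good `𝒪_D`-model `E = curveFO F (W_D ⊗_ψ 𝒪_F)`.**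
HYPOTHESIS `hformal` (T5-C's output shape, with the division sequence allowed to be formal at every level): for some `c ∈ F`, for every
`η ∈ Z¹(Γ_F, T_pE)`, every `P ∈ E(F)`, every `p`-power division sequence `Q` of `P` in `E(F̄)` lying in `E₁(ℂ_F)` at EVERY level with `‖z(Q₀)‖^N ≤ ‖p‖`, and
every `c_P ∈ F` with `ι(c_P) = p^N·Σ'[Xʲ]log_{W_D}·z(Q₀)ʲ`: `⟨[η], P⟩ = −Tr_{F/ℚ_p}(c_P · exp*_d(η) · c)`. CONCLUSION: ONE `c' ∈ F` with
**`⟨[η], P⟩ = Tr_{F/ℚ_p}(c' · exp*_d(η) · log_ω(P))` for every `η` and EVERY `P ∈ E(F)`**, `log_ω = padicLogPointFiniteExt w E p`. Inputs: `Δ ∈ 𝒪_Fˣ`,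
`[Xᵖ][p]` a unit in `𝒪_{ℂ_F}` (formal division towers of `F̄`-points, `FormalDivisionTowersOrdinary.exists_divSeq_geomToCO_mem_kernel`), `N ≥ 1`; the chart
`AinfTop.algebraMap_pow_mul_padicLogPointFiniteExt_curveFO_eq` on the level and the index step `ReciprocityFormulaOffLevel.eq_neg_trace_mul_of_forall_level`
(`c' = −p^N·c`). [cite: Kato1993LNM1553, Ch. II Thm. 1.4.1 (3)–(4), Lemma 1.4.3] [cite: BlochKato1990, Ex. 3.10.1, Example 3.11]
[cite: SilvermanAEC2009, Thm. IV.6.4, Prop. VII.2.1–VII.2.2] -/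
theorem exists_const_tatePairingPoint_eq_trace_mul_padicLog_of_formalPoints {N : ℕ} (hN0 : N ≠ 0)
    (d : letI := LocalField.padicAlgebra (v.adicCompletion K) p hpv
      (bdRPeriodRingData (F := (v.adicCompletion K)) (p := p) hpv).FilZeroLine
        (restrictedRationalTateRep (AinfTop.curveFO (v.adicCompletion K) (Wm.map ψm)) (v.adicCompletion K) p))
    (hformal : letI := LocalField.padicAlgebra (v.adicCompletion K) p hpv
      ∃ c : v.adicCompletion K,
      ∀ (η : contOneCocycles (restrictedTateRep (AinfTop.curveFO (v.adicCompletion K) (Wm.map ψm)) (v.adicCompletion K) p).toTopRep)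
        (P : ((AinfTop.curveFO (v.adicCompletion K) (Wm.map ψm)).baseChange (v.adicCompletion K)).toAffine.Point)
        (Q : ℕ → geomPoints ((AinfTop.curveFO (v.adicCompletion K) (Wm.map ψm)).baseChange (v.adicCompletion K)))
        (_hQ : ∀ n, p • Q (n + 1) = Q n)
        (_hQ0 : Q 0 = toGeomPoints ((AinfTop.curveFO (v.adicCompletion K) (Wm.map ψm)).baseChange (v.adicCompletion K)) P)
        (hker : ∀ n, AinfTop.geomToCO (Wm.map ψm) (Q n) ∈ kernel (NormedField.valuation (K := CompletedAlgClosure (v.adicCompletion K)))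
          (curveOver (CompletedAlgClosure (v.adicCompletion K)) (Wm.map ψm))),
        ‖((zPt (AinfTop.geomToCO (Wm.map ψm) (Q 0)) (hker 0) : CBall (v.adicCompletion K)) : CompletedAlgClosure (v.adicCompletion K))‖ ^ N ≤
            ‖(p : CompletedAlgClosure (v.adicCompletion K))‖ →
        ∀ cP : v.adicCompletion K,
          algebraMap (v.adicCompletion K) (CompletedAlgClosure (v.adicCompletion K)) cP =
            (p : CompletedAlgClosure (v.adicCompletion K)) ^ N *
              ∑' j : ℕ, PowerSeries.coeff j (Wm.map ((CBall (v.adicCompletion K)).subtype.comp (EisensteinRoot.CoeffDisc.toCBall Dv))).formalLog *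
                ((zPt (AinfTop.geomToCO (Wm.map ψm) (Q 0)) (hker 0) : CBall (v.adicCompletion K)) : CompletedAlgClosure (v.adicCompletion K)) ^ j →
          ((tatePairingPoint (AinfTop.curveFO (v.adicCompletion K) (Wm.map ψm)) (v.adicCompletion K) p e hμ hadd₁ hadd₂ hgal hcompat
              (oneCocycleClass _ η) P : ℤ_[p]) : ℚ_[p]) =
            -Algebra.trace ℚ_[p] (v.adicCompletion K) (cP * (expStarCoord (AinfTop.curveFO (v.adicCompletion K) (Wm.map ψm)) hpv d η * c))) :
    letI := LocalField.padicAlgebra (v.adicCompletion K) p hpv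
    ∃ c : v.adicCompletion K,
      ∀ (η : contOneCocycles (restrictedTateRep (AinfTop.curveFO (v.adicCompletion K) (Wm.map ψm)) (v.adicCompletion K) p).toTopRep)
        (P : ((AinfTop.curveFO (v.adicCompletion K) (Wm.map ψm)).baseChange (v.adicCompletion K)).toAffine.Point),
        ((tatePairingPoint (AinfTop.curveFO (v.adicCompletion K) (Wm.map ψm)) (v.adicCompletion K) p e hμ hadd₁ hadd₂ hgal hcompat
            (oneCocycleClass _ η) P : ℤ_[p]) : ℚ_[p]) =
          Algebra.trace ℚ_[p] (v.adicCompletion K)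
            (c * expStarCoord (AinfTop.curveFO (v.adicCompletion K) (Wm.map ψm)) hpv d η *
              padicLogPointFiniteExt w (AinfTop.curveFO (v.adicCompletion K) (Wm.map ψm)) p P) := by
  letI := LocalField.padicAlgebra (v.adicCompletion K) p hpv
  obtain ⟨c₀, hc₀⟩ := hformal
  refine ⟨-((p : v.adicCompletion K) ^ N * c₀), fun η P => ?_⟩
  have hp0 : (p : v.adicCompletion K) ≠ 0 := Nat.cast_ne_zero.2 hprime.out.ne_zero
  have hpw : w (p : v.adicCompletion K) < 1 := (ValuativeRel.isEquiv w (valuation (v.adicCompletion K))).lt_one_iff_lt_one.mpr hpv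
  have hpC : ‖(p : CompletedAlgClosure (v.adicCompletion K))‖ < 1 := norm_natCast_C_lt_one hpv
  have hℓ := limitLog_spec_of_isNonarchimedeanLocalField (AinfTop.curveFO (v.adicCompletion K) (Wm.map ψm)) w hp0 hpv
  -- every point has a positive multiple in the level
  obtain ⟨m, hm, hmP⟩ := exists_nsmul_mem_level_of_isNonarchimedeanLocalField (AinfTop.curveFO (v.adicCompletion K) (Wm.map ψm)) w hp0
    (P : (AinfTop.curveFO (v.adicCompletion K) (Wm.map ψm)).toAffine.Point)
  -- the formula ON the level, with `c_Q := p^N · log_ω Q` (chart) and a FORMAL division sequence of `Q` (chosen at every level)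
  have hlevel : ∀ Q ∈ level w (AinfTop.curveFO (v.adicCompletion K) (Wm.map ψm)) (w (p : v.adicCompletion K)),
      ((tatePairingPoint (AinfTop.curveFO (v.adicCompletion K) (Wm.map ψm)) (v.adicCompletion K) p e hμ hadd₁ hadd₂ hgal hcompat
          (oneCocycleClass _ η) Q : ℤ_[p]) : ℚ_[p]) =
        -Algebra.trace ℚ_[p] (v.adicCompletion K)
          ((p : v.adicCompletion K) ^ N * (expStarCoord (AinfTop.curveFO (v.adicCompletion K) (Wm.map ψm)) hpv d η * c₀) *
            padicLogPointFiniteExt w (AinfTop.curveFO (v.adicCompletion K) (Wm.map ψm)) p Q) := by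
    intro Q hQ
    have hker0 : AinfTop.geomToCO (Wm.map ψm) (toGeomPoints (AinfTop.curveFO (v.adicCompletion K) (Wm.map ψm)) Q) ∈
        kernel (NormedField.valuation (K := CompletedAlgClosure (v.adicCompletion K)))
          (curveOver (CompletedAlgClosure (v.adicCompletion K)) (Wm.map ψm)) :=
      AinfTop.geomToCO_toGeomPoints_mem_kernel _ w hQ.1
    obtain ⟨Qs, hQs0, hQs, hkerQ⟩ :=
      AinfTop.exists_divSeq_geomToCO_mem_kernel (Wm.map ψm) hpC hΔ h1 (toGeomPoints (AinfTop.curveFO (v.adicCompletion K) (Wm.map ψm)) Q) hker0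
    have hz : ((zPt (AinfTop.geomToCO (Wm.map ψm) (Qs 0)) (hkerQ 0) : CBall (v.adicCompletion K)) : CompletedAlgClosure (v.adicCompletion K)) =
        (AinfTop.geomToCO (Wm.map ψm) (toGeomPoints (AinfTop.curveFO (v.adicCompletion K) (Wm.map ψm)) Q)).zCoord := by
      rw [coe_zPt, hQs0]
    have hdepth : ‖((zPt (AinfTop.geomToCO (Wm.map ψm) (Qs 0)) (hkerQ 0) : CBall (v.adicCompletion K)) : CompletedAlgClosure (v.adicCompletion K))‖ ^ N ≤
        ‖(p : CompletedAlgClosure (v.adicCompletion K))‖ := by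
      rw [hz]; exact AinfTop.norm_zCoord_geomToCO_toGeomPoints_pow_le (Wm.map ψm) hpv w hQ hN0
    have hcP : algebraMap (v.adicCompletion K) (CompletedAlgClosure (v.adicCompletion K))
        ((p : v.adicCompletion K) ^ N * padicLogPointFiniteExt w (AinfTop.curveFO (v.adicCompletion K) (Wm.map ψm)) p Q) =
        (p : CompletedAlgClosure (v.adicCompletion K)) ^ N *
          ∑' j : ℕ, PowerSeries.coeff j (Wm.map ((CBall (v.adicCompletion K)).subtype.comp (EisensteinRoot.CoeffDisc.toCBall Dv))).formalLog *
            ((zPt (AinfTop.geomToCO (Wm.map ψm) (Qs 0)) (hkerQ 0) : CBall (v.adicCompletion K)) : CompletedAlgClosure (v.adicCompletion K)) ^ j := by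
      rw [hz]; exact AinfTop.algebraMap_pow_mul_padicLogPointFiniteExt_curveFO_eq Dv Wm ψm hψm w hQ N
    have hmain := hc₀ η Q Qs hQs hQs0 hkerQ hdepth _ hcP
    rw [hmain, mul_assoc, mul_comm (padicLogPointFiniteExt w _ p Q), ← mul_assoc]
  -- off the level
  have key := eq_neg_trace_mul_of_forall_level w (AinfTop.curveFO (v.adicCompletion K) (Wm.map ψm)) hp0 hpw hℓ
    (tatePairingPoint (AinfTop.curveFO (v.adicCompletion K) (Wm.map ψm)) (v.adicCompletion K) p e hμ hadd₁ hadd₂ hgal hcompat (oneCocycleClass _ η))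
    ((p : v.adicCompletion K) ^ N * (expStarCoord (AinfTop.curveFO (v.adicCompletion K) (Wm.map ψm)) hpv d η * c₀)) hlevel hm hmP
  -- `key` speaks of `P` as a point of `E` (= `E.baseChange F` definitionally): close by `trans` (defeq), not `rw`
  refine key.trans ?_
  rw [← map_neg]
  congr 1
  ring

end Summit.BirchSwinnertonDyer.BirchSwinnertonDyer.Theorems.TransportedReciprocityAllPointsOfFormalPoints

end
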